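import Summits.AnomalousDissipation.AnomalousDissipation.Theorems.SoloInformedMomentumBalance
import Literature.Analysis.FluidPDE.LerayHopfGalileanTorus
import HarnessLib

/-!
# The laminar dissipation floor of a Leray–Hopf solution (solo-informed)

The summit `AnomalousDissipation` (= `Literature.Turb.ZerothLaw`) asks for a dissipation floor
`⟨ν_j ‖∇u_j‖₂²⟩ ≥ ε > 0` UNIFORM along a vanishing-viscosity Leray–Hopf family under one fixed
smooth force.  This file records the unconditional floor that every single Leray–Hopf solution
obeys and its order in `ν` — the bottom of the window in which a witness has to live
(`SoloInformedDriftRateCeiling` exhibits fixed-force bounded-energy families with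
`⟨ν‖∇u‖²⟩ ≤ C_θ ν^θ` for every `θ < 1`, so the window `[c ν, ε]` is populated near its floor).

For a global Leray–Hopf solution `u` on `T^d` (viscosity `ν > 0`, steady force `F ∈ L²` of zero
mean) the momentum `m = ∫ u(t) dx` is the same at all times `t > 0`
(`Literature.Analysis.FluidPDE.Torus.IsLerayHopfOn.integral_inner_const_eq`), and the SHARP
Poincaré inequality with mean, `4π² (‖w‖₂² - ‖∫w‖²) ≤ ‖∇w‖₂²` (first eigenvalue `4π²` of the
Stokes operator on the unit torus; `fourPiSq_mul_lintegral_enorm_sq_le`), holds at a.e. time.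
Averaging in time with honest `limsup` means (both running means are eventually bounded,
`…isBoundedUnder_timeMean_energy` / `…_dissipation`, and `x ↦ a x - b` commutes with `limsup`):

* `lerayHopf_meanDissipation_ge_variance` — **the floor**
  `4π² ν (⟨‖u‖₂²⟩ - ‖m‖²) ≤ ⟨ν ‖∇u‖₂²⟩ = meanDissipation ν u`, `m = ∫ u(s)` for any `s > 0`;
* `lerayHopf_meanDissipation_ge_meanEnergy` — zero-momentum data: `4π² ν ⟨‖u‖₂²⟩ ≤ ⟨ν‖∇u‖₂²⟩`;
* `lerayHopf_laminarFloor` — combined with the momentum balance in the forcing mode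
  (`lerayHopf_force_normSq_le_meanEnergy`: `‖f‖₂² ≤ G⟨‖u‖₂²⟩ + ν‖Δf‖₂⟨‖u‖₂²⟩^{1/2}` for
  `∑ᵢ‖∂ᵢf‖ ≤ G`): `4π² ν (‖f‖₂² - ν ‖Δf‖₂ ⟨‖u‖₂²⟩^{1/2}) / G ≤ ⟨ν‖∇u‖₂²⟩` — an explicit
  order-`ν` floor depending on the force alone up to `O(ν²)`;
* `zerothLawFamily_laminarFloor` — along any fixed-force vanishing-viscosity Leray–Hopf family
  with zero-momentum data and `⟨‖u_j‖₂²⟩ ≤ E`: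
  `4π² ν_j (‖f‖₂² - ν_j ‖Δf‖₂ √E) / G ≤ meanDissipation ν_j u_j`, i.e.
  `liminf_j meanDissipation(ν_j,u_j)/ν_j ≥ 4π² ‖f‖₂² / ‖∇f‖_{∞,1}`: no family dissipates at a
  sub-laminar rate, and the zeroth law asks for the rate `ν_j⁰` at the other end of the window.

References: Doering–Foias, J. Fluid Mech. 467 (2002) 289–306, §3 (laminar lower bound
`ε ≥ ν U²/ℓ²`) [DoeringFoias2002]; Foias–Manley–Rosa–Temam, *Navier–Stokes Equations and
Turbulence* (2001) Ch. II App. A (A.38)–(A.42), Ch. IV (1.13) [FMRT2001].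
-/

noncomputable section

open MeasureTheory Filter Topology Set UnitAddTorus
open scoped ENNReal NNReal InnerProductSpace RealInnerProductSpace

namespace Summit.AnomalousDissipation.AnomalousDissipation.Theorems

open Literature.Analysis.FunctionSpaces Literature.Analysis.FluidPDE

variable {d : Type*} [Fintype d] [DecidableEq d]

/-! ## Sharp Poincaré with mean -/

omit [DecidableEq d] in
/-- **Poincaré with mean, sharp constant** (`ℝ≥0∞` form): for `w ∈ L²(T^d; ℝ^d)`,
`4π² ∫⁻‖w‖ₑ² ≤ 4π² ‖∫w‖ₑ² + ‖∇w‖₂²` (Parseval; the zero mode is the mean and `|k|² ≥ 1` at the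
others; FMRT 2001 Ch. IV (1.13)). [cite: FMRT2001, Ch. IV (1.13)] -/
theorem fourPiSq_mul_lintegral_enorm_sq_le {w : UnitAddTorus d → EuclideanSpace ℝ d}
    (hw : MemLp w 2 volume) :
    ENNReal.ofReal (4 * Real.pi ^ 2) * ∫⁻ x, ‖w x‖ₑ ^ 2 ≤
      ENNReal.ofReal (4 * Real.pi ^ 2) * ‖∫ x, w x‖ₑ ^ 2 + Torus.eGradNormSq w := by
  classical
  have hwi : Integrable w volume := hw.integrable one_le_two
  rw [← Torus.tsum_enorm_sq_mFourierCoeff_complexify hw, ENNReal.tsum_eq_add_tsum_ite (0 : d → ℤ),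
    mul_add]
  have h0 : ‖mFourierCoeff (EuclideanSpace.complexify ∘ w) 0‖ₑ ^ 2 = ‖∫ x, w x‖ₑ ^ 2 := by
    rw [Literature.Analysis.FluidPDE.Torus.mFourierCoeff_complexify_zero_eq hwi, ← ofReal_norm,
      EuclideanSpace.norm_complexify, ofReal_norm]
  rw [h0]
  refine add_le_add le_rfl ?_
  rw [Torus.eGradNormSq_eq_tsum]
  refine mul_le_mul_of_nonneg_left (ENNReal.tsum_le_tsum fun k => ?_) zero_le
  split_ifs with hk
  · exact zero_le
  · exact le_mul_of_one_le_left zero_le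
      (ENNReal.one_le_ofReal.2 (Torus.one_le_freqNormSq_of_ne_zero hk))

omit [DecidableEq d] in
/-- **Poincaré with mean, sharp constant**, real form: for `w ∈ L²` with `‖∇w‖₂² < ∞`,
`4π² (∫‖w‖² - ‖∫w‖²) ≤ ‖∇w‖₂²`. [cite: FMRT2001, Ch. IV (1.13)] -/
theorem fourPiSq_mul_variance_le_toReal_eGradNormSq {w : UnitAddTorus d → EuclideanSpace ℝ d}
    (hw : MemLp w 2 volume) (hG : Torus.eGradNormSq w ≠ ⊤) :
    4 * Real.pi ^ 2 * ((∫ x, ‖w x‖ ^ 2) - ‖∫ x, w x‖ ^ 2) ≤ (Torus.eGradNormSq w).toReal := by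
  have h := fourPiSq_mul_lintegral_enorm_sq_le hw
  have hc : 0 ≤ 4 * Real.pi ^ 2 := by positivity
  rw [Literature.Analysis.FluidPDE.Torus.lintegral_enorm_sq_eq_ofReal hw, ← ofReal_norm,
    ← ENNReal.ofReal_pow (norm_nonneg _), ← ENNReal.ofReal_mul hc, ← ENNReal.ofReal_mul hc,
    ← ENNReal.ofReal_toReal hG, ← ENNReal.ofReal_add (by positivity) ENNReal.toReal_nonneg,
    ENNReal.ofReal_le_ofReal_iff (by positivity)] at h
  linarith

/-! ## `limsup` bookkeeping -/

omit [Fintype d] [DecidableEq d] in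
/-- If `a e(T) - b ≤ g(T)` eventually, with `a ≥ 0`, `e ≥ 0` eventually and `e`, `g` eventually
bounded above, then `a limsup e - b ≤ limsup g` (`x ↦ a x - b` commutes with `limsup`,
`Monotone.map_limsup_of_continuousAt`). [folklore] -/
theorem affine_limsup_le_limsup {e g : ℝ → ℝ} {a b : ℝ} (ha : 0 ≤ a)
    (hle : ∀ᶠ T in atTop, a * e T - b ≤ g T) (he0 : ∀ᶠ T in atTop, 0 ≤ e T)
    (he : IsBoundedUnder (· ≤ ·) atTop e) (hg : IsBoundedUnder (· ≤ ·) atTop g) :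
    a * limsup e atTop - b ≤ limsup g atTop := by
  have hco : IsCoboundedUnder (· ≤ ·) atTop e := isCoboundedUnder_le_of_eventually_le atTop he0
  have hmono : Monotone fun x : ℝ => a * x - b := fun x y hxy =>
    sub_le_sub_right (mul_le_mul_of_nonneg_left hxy ha) b
  have hcont : Continuous fun x : ℝ => a * x - b :=
    (continuous_const.mul continuous_id).sub continuous_const
  have h1 : a * limsup e atTop - b = limsup (fun T => a * e T - b) atTop := by
    have h2 := hmono.map_limsup_of_continuousAt e hcont.continuousAt he hco
    simpa [Function.comp_def] using h2
  rw [h1]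
  refine limsup_le_limsup hle ?_ hg
  exact isCoboundedUnder_le_of_eventually_le atTop
    (he0.mono fun T hT => show -b ≤ a * e T - b by nlinarith [mul_nonneg ha hT])

/-! ## One Leray–Hopf solution -/

section OneSolution

variable {ν : ℝ} {F u₀ : UnitAddTorus d → EuclideanSpace ℝ d}
  {u : ℝ → UnitAddTorus d → EuclideanSpace ℝ d}

/-- **Momentum is fixed by the datum**: for a global Leray–Hopf solution with steady mean-zero
force `F ∈ L²` and a measurable datum, `∫ u(t) = ∫ u₀` for every `t > 0` (the time-sliced weak
formulation tested with constant fields). [folklore] -/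
theorem lerayHopf_integral_eq_integral_datum (hF : MemLp F 2 volume) (hF0 : Torus.HasZeroMean F)
    (hu : Torus.IsGlobalLerayHopf ν (fun _ => F) u₀ u) (hm₀ : AEStronglyMeasurable u₀ volume)
    {t : ℝ} (ht : 0 < t) : ∫ x, u t x = ∫ x, u₀ x := by
  have hFi : Integrable F volume := hF.integrable one_le_two
  have hconst : ∀ e : EuclideanSpace ℝ d, ∫ x, ⟪u t x, e⟫ = ∫ x, ⟪u₀ x, e⟫ := fun e => by
    rw [(hu t ht).integral_inner_const_eq ht
      (Literature.Analysis.FluidPDE.Torus.aestronglyMeasurable_stLift_steady hF.1 (Ioo 0 t))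
      (Literature.Analysis.FluidPDE.Torus.lintegral_enorm_sq_steady_lt_top' hF t) e ⟨ht, le_rfl⟩]
    have h0 : (∫ x, ⟪F x, e⟫) = 0 := by
      rw [show (∫ x, ⟪F x, e⟫) = ∫ x, ⟪e, F x⟫ from
          integral_congr_ae (ae_of_all _ fun x => real_inner_comm _ _),
        integral_inner hFi e, show (∫ x, F x) = 0 from hF0, inner_zero_right]
    simp [h0]
  have hut : Integrable (u t) volume := (hu.memLp_two ht.le).integrable one_le_two
  have hu0 : Integrable u₀ volume := (hu.memLp_two_datum hm₀).integrable one_le_two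
  refine ext_inner_left ℝ fun e => ?_
  rw [← integral_inner hut e, ← integral_inner hu0 e]
  have h1 := hconst e
  simp_rw [real_inner_comm e] at h1
  exact h1

/-- **The floor on running means**: for `T > 0` and any `s > 0`,
`4π² ν (T⁻¹∫₀ᵀ ‖u‖₂² - ‖∫u(s)‖²) ≤ T⁻¹∫₀ᵀ ν‖∇u‖₂²` (Poincaré with mean at a.e. time, where
`‖∇u(t)‖₂² < ∞`, integrated). [cite: DoeringFoias2002, §3] -/
theorem lerayHopf_timeMean_dissipation_ge (hF : MemLp F 2 volume) (hF0 : Torus.HasZeroMean F)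
    (hu : Torus.IsGlobalLerayHopf ν (fun _ => F) u₀ u) (hν : 0 ≤ ν) {s : ℝ} (hs : 0 < s)
    {T : ℝ} (hT : 0 < T) :
    4 * Real.pi ^ 2 * ν * (timeMean (fun t => ∫ x, ‖u t x‖ ^ 2) T - ‖∫ x, u s x‖ ^ 2) ≤
      timeMean (fun t => ν * (Torus.eGradNormSq (u t)).toReal) T := by
  set m2 : ℝ := ‖∫ x, u s x‖ ^ 2 with hm2
  have hLH := hu T hT
  have hmeas := hLH.aemeasurable_eGradNormSq
  have hfin := hLH.lintegral_eGradNormSq_lt_top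
  have hlt : ∀ᵐ τ ∂(volume.restrict (Ioo 0 T)), Torus.eGradNormSq (u τ) < ⊤ :=
    ae_lt_top' hmeas hfin.ne
  have hGi : IntegrableOn (fun τ => (Torus.eGradNormSq (u τ)).toReal) (Ioo 0 T) :=
    integrable_toReal_of_lintegral_ne_top hmeas hfin.ne
  have hyi : IntegrableOn (fun τ => ∫ x, ‖u τ x‖ ^ 2) (Ioo 0 T) :=
    hLH.integrableOn_integral_norm_sq
  haveI : IsFiniteMeasure (volume.restrict (Ioo 0 T)) :=
    ⟨by rw [Measure.restrict_apply_univ]; exact measure_Ioo_lt_top⟩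
  have hci : Integrable (fun _ : ℝ => m2) (volume.restrict (Ioo 0 T)) := integrable_const m2
  -- Poincaré with mean at a.e. time
  have hae : ∀ᵐ τ ∂(volume.restrict (Ioo 0 T)),
      4 * Real.pi ^ 2 * ((∫ x, ‖u τ x‖ ^ 2) - m2) ≤ (Torus.eGradNormSq (u τ)).toReal := by
    filter_upwards [hlt, ae_restrict_mem measurableSet_Ioo] with τ hτ hτm
    rw [hm2, ← hu.integral_eq_integral_of_hasZeroMean hF hF0 hs hτm.1]
    exact fourPiSq_mul_variance_le_toReal_eGradNormSq (hu.memLp_two hτm.1.le) hτ.ne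
  have hint : ∫ τ in Ioo 0 T, 4 * Real.pi ^ 2 * ((∫ x, ‖u τ x‖ ^ 2) - m2) ≤
      ∫ τ in Ioo 0 T, (Torus.eGradNormSq (u τ)).toReal :=
    integral_mono_ae ((hyi.sub hci).const_mul _) hGi hae
  rw [integral_const_mul, integral_sub hyi hci, setIntegral_const, Real.volume_real_Ioo_of_le hT.le,
    sub_zero, smul_eq_mul] at hint
  -- running means
  unfold timeMean
  rw [intervalIntegral.integral_of_le hT.le, intervalIntegral.integral_of_le hT.le,
    integral_Ioc_eq_integral_Ioo, integral_Ioc_eq_integral_Ioo, integral_const_mul]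
  have hT0 : T ≠ 0 := hT.ne'
  have key := mul_le_mul_of_nonneg_left hint (show 0 ≤ ν * T⁻¹ by positivity)
  have e1 : ν * T⁻¹ * (4 * Real.pi ^ 2 * ((∫ τ in Ioo 0 T, ∫ x, ‖u τ x‖ ^ 2) - T * m2)) =
      4 * Real.pi ^ 2 * ν * (T⁻¹ * (∫ τ in Ioo 0 T, ∫ x, ‖u τ x‖ ^ 2) - m2) := by
    field_simp
  have e2 : ν * T⁻¹ * ∫ τ in Ioo 0 T, (Torus.eGradNormSq (u τ)).toReal =
      T⁻¹ * (ν * ∫ τ in Ioo 0 T, (Torus.eGradNormSq (u τ)).toReal) := by ring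
  linarith

/-- **The laminar dissipation floor** (honest `limsup` means, any momentum): for `ν > 0`, a
steady mean-zero force `F ∈ L²` and any `s > 0`,
`4π² ν (⟨‖u‖₂²⟩ - ‖∫u(s)‖²) ≤ meanDissipation ν u = ⟨ν‖∇u‖₂²⟩`.
[cite: DoeringFoias2002, §3] -/
theorem lerayHopf_meanDissipation_ge_variance (hν : 0 < ν) (hF : MemLp F 2 volume)
    (hF0 : Torus.HasZeroMean F) (hu : Torus.IsGlobalLerayHopf ν (fun _ => F) u₀ u)
    {s : ℝ} (hs : 0 < s) :
    4 * Real.pi ^ 2 * ν * (meanEnergy u - ‖∫ x, u s x‖ ^ 2) ≤ meanDissipation ν u := by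
  have h := affine_limsup_le_limsup (a := 4 * Real.pi ^ 2 * ν)
    (b := 4 * Real.pi ^ 2 * ν * ‖∫ x, u s x‖ ^ 2)
    (e := timeMean fun t => ∫ x, ‖u t x‖ ^ 2)
    (g := timeMean fun t => ν * (Torus.eGradNormSq (u t)).toReal) (by positivity)
    ((eventually_gt_atTop 0).mono fun T hT => by
      have h1 := lerayHopf_timeMean_dissipation_ge hF hF0 hu hν.le hs hT
      linarith)
    ((eventually_ge_atTop 0).mono fun T hT =>
      timeMean_nonneg (fun t => integral_nonneg fun _ => sq_nonneg _) hT)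
    (hu.isBoundedUnder_timeMean_energy hν hF hF0)
    (hu.isBoundedUnder_timeMean_dissipation hν hF hF0)
  rw [show meanEnergy u = limsup (timeMean fun t => ∫ x, ‖u t x‖ ^ 2) atTop from rfl,
    show meanDissipation ν u =
      limsup (timeMean fun t => ν * (Torus.eGradNormSq (u t)).toReal) atTop from rfl]
  linarith

/-- **Zero momentum**: with a measurable mean-zero datum, `4π² ν ⟨‖u‖₂²⟩ ≤ ⟨ν‖∇u‖₂²⟩`.
[cite: DoeringFoias2002, §3] -/
theorem lerayHopf_meanDissipation_ge_meanEnergy (hν : 0 < ν) (hF : MemLp F 2 volume)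
    (hF0 : Torus.HasZeroMean F) (hu : Torus.IsGlobalLerayHopf ν (fun _ => F) u₀ u)
    (hm₀ : AEStronglyMeasurable u₀ volume) (hu₀ : Torus.HasZeroMean u₀) :
    4 * Real.pi ^ 2 * ν * meanEnergy u ≤ meanDissipation ν u := by
  have h := lerayHopf_meanDissipation_ge_variance hν hF hF0 hu one_pos
  rw [lerayHopf_integral_eq_integral_datum hF hF0 hu hm₀ one_pos,
    show (∫ x, u₀ x) = 0 from hu₀, norm_zero, zero_pow two_ne_zero, sub_zero] at h
  exact h

/-- **The laminar floor in terms of the force**: for a steady smooth divergence-free mean-zero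
force with `∑ᵢ ‖∂ᵢ f‖ ≤ G`, `0 < G`, and a measurable mean-zero datum,
`4π² ν (‖f‖₂² - ν ‖Δf‖₂ ⟨‖u‖₂²⟩^{1/2}) / G ≤ meanDissipation ν u` (the floor above combined with
the forcing-mode momentum balance `‖f‖₂² ≤ G⟨‖u‖₂²⟩ + ν‖Δf‖₂⟨‖u‖₂²⟩^{1/2}`).
[cite: DoeringFoias2002, §3] -/
theorem lerayHopf_laminarFloor {f : UnitAddTorus d → EuclideanSpace ℝ d} (hν : 0 < ν)
    (hf : Torus.IsSmooth f) (hdiv : Torus.IsDivFree f) (hmean : Torus.HasZeroMean f)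
    (hu : Torus.IsGlobalLerayHopf ν (fun _ => f) u₀ u) (hm₀ : AEStronglyMeasurable u₀ volume)
    (hu₀ : Torus.HasZeroMean u₀) {G : ℝ} (hG : ∀ x, ∑ i, ‖Torus.partialDeriv i f x‖ ≤ G)
    (hG0 : 0 < G) :
    4 * Real.pi ^ 2 * ν * ((∫ x, ‖f x‖ ^ 2)
        - ν * Real.sqrt (∫ x, ‖Torus.laplacian f x‖ ^ 2) * Real.sqrt (meanEnergy u)) / G ≤
      meanDissipation ν u := by
  have h1 := lerayHopf_force_normSq_le_meanEnergy hν hf hdiv hmean hu hG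
  have h2 := lerayHopf_meanDissipation_ge_meanEnergy hν (hf.memLp 2) hmean hu hm₀ hu₀
  have h3 : ((∫ x, ‖f x‖ ^ 2)
      - ν * Real.sqrt (∫ x, ‖Torus.laplacian f x‖ ^ 2) * Real.sqrt (meanEnergy u)) / G ≤
      meanEnergy u := by
    rw [div_le_iff₀ hG0]; linarith
  calc 4 * Real.pi ^ 2 * ν * ((∫ x, ‖f x‖ ^ 2)
        - ν * Real.sqrt (∫ x, ‖Torus.laplacian f x‖ ^ 2) * Real.sqrt (meanEnergy u)) / G
      = 4 * Real.pi ^ 2 * ν * (((∫ x, ‖f x‖ ^ 2)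
        - ν * Real.sqrt (∫ x, ‖Torus.laplacian f x‖ ^ 2) * Real.sqrt (meanEnergy u)) / G) := by
        ring
    _ ≤ 4 * Real.pi ^ 2 * ν * meanEnergy u := mul_le_mul_of_nonneg_left h3 (by positivity)
    _ ≤ meanDissipation ν u := h2

end OneSolution

/-! ## Vanishing-viscosity families under one force -/

/-- **No sub-laminar families.** Along any vanishing-viscosity family of global Leray–Hopf
solutions driven by ONE steady smooth divergence-free mean-zero force `f` (`∑ᵢ ‖∂ᵢ f‖ ≤ G`,
`0 < G`), with measurable zero-momentum data and `⟨‖u_j‖₂²⟩ ≤ E`: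
`4π² ν_j (‖f‖₂² - ν_j ‖Δf‖₂ √E) / G ≤ meanDissipation ν_j u_j` for every `j` — the dissipation
is at least laminar, `≳ ν_j ‖f‖₂²/‖∇f‖_∞`, while `Literature.Turb.ZerothLaw` asks for `≥ ε`.
[cite: DoeringFoias2002, §3] -/
theorem zerothLawFamily_laminarFloor {f : UnitAddTorus d → EuclideanSpace ℝ d}
    (hf : Torus.IsSmooth f) (hdiv : Torus.IsDivFree f) (hmean : Torus.HasZeroMean f) {G : ℝ}
    (hG : ∀ x, ∑ i, ‖Torus.partialDeriv i f x‖ ≤ G) (hG0 : 0 < G) {ν : ℕ → ℝ}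
    {u₀ : ℕ → UnitAddTorus d → EuclideanSpace ℝ d}
    {u : ℕ → ℝ → UnitAddTorus d → EuclideanSpace ℝ d} (hν : ∀ j, 0 < ν j)
    (hLH : ∀ j, Torus.IsGlobalLerayHopf (ν j) (fun _ => f) (u₀ j) (u j))
    (hm₀ : ∀ j, AEStronglyMeasurable (u₀ j) volume) (hu₀ : ∀ j, Torus.HasZeroMean (u₀ j))
    {E : ℝ} (hE : ∀ j, meanEnergy (u j) ≤ E) (j : ℕ) :
    4 * Real.pi ^ 2 * ν j * ((∫ x, ‖f x‖ ^ 2)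
        - ν j * Real.sqrt (∫ x, ‖Torus.laplacian f x‖ ^ 2) * Real.sqrt E) / G ≤
      meanDissipation (ν j) (u j) := by
  have h := lerayHopf_laminarFloor (hν j) hf hdiv hmean (hLH j) (hm₀ j) (hu₀ j) hG hG0
  have hmono : ν j * Real.sqrt (∫ x, ‖Torus.laplacian f x‖ ^ 2) * Real.sqrt (meanEnergy (u j)) ≤
      ν j * Real.sqrt (∫ x, ‖Torus.laplacian f x‖ ^ 2) * Real.sqrt E :=
    mul_le_mul_of_nonneg_left (Real.sqrt_le_sqrt (hE j))
      (mul_nonneg (hν j).le (Real.sqrt_nonneg _))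
  refine le_trans ?_ h
  have hc : 0 ≤ 4 * Real.pi ^ 2 * ν j / G := by have := (hν j).le; positivity
  have := mul_le_mul_of_nonneg_left (sub_le_sub_left hmono (∫ x, ‖f x‖ ^ 2)) hc
  calc 4 * Real.pi ^ 2 * ν j * ((∫ x, ‖f x‖ ^ 2)
        - ν j * Real.sqrt (∫ x, ‖Torus.laplacian f x‖ ^ 2) * Real.sqrt E) / G
      = 4 * Real.pi ^ 2 * ν j / G * ((∫ x, ‖f x‖ ^ 2)
        - ν j * Real.sqrt (∫ x, ‖Torus.laplacian f x‖ ^ 2) * Real.sqrt E) := by ring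
    _ ≤ 4 * Real.pi ^ 2 * ν j / G * ((∫ x, ‖f x‖ ^ 2)
        - ν j * Real.sqrt (∫ x, ‖Torus.laplacian f x‖ ^ 2) * Real.sqrt (meanEnergy (u j))) := this
    _ = _ := by ring

/-- **The dissipation window of a zeroth-law witness.** A witness `(f, ν_j, u_j, E, ε)` of
`AnomalousDissipation` with measurable zero-momentum data has, for every `∑ᵢ‖∂ᵢ f‖ ≤ G`, `0 < G`,
BOTH `ε ≤ meanDissipation ν_j u_j` (the summit's floor, rate `ν_j⁰`) and the laminar floor
`4π² ν_j (‖f‖₂² - ν_j‖Δf‖₂√E)/G ≤ meanDissipation ν_j u_j` (rate `ν_j¹`); the content of the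
summit is the gap between the two exponents. [cite: DoeringFoias2002, §3] -/
theorem zerothLawWitness_dissipationWindow {f : UnitAddTorus (Fin 3) → EuclideanSpace ℝ (Fin 3)}
    (hf : Torus.IsSmooth f) (hdiv : Torus.IsDivFree f) (hmean : Torus.HasZeroMean f) {G : ℝ}
    (hG : ∀ x, ∑ i, ‖Torus.partialDeriv i f x‖ ≤ G) (hG0 : 0 < G) {ν : ℕ → ℝ}
    {u₀ : ℕ → UnitAddTorus (Fin 3) → EuclideanSpace ℝ (Fin 3)}
    {u : ℕ → ℝ → UnitAddTorus (Fin 3) → EuclideanSpace ℝ (Fin 3)} (hν : ∀ j, 0 < ν j)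
    (hLH : ∀ j, Torus.IsGlobalLerayHopf (ν j) (fun _ => f) (u₀ j) (u j))
    (hm₀ : ∀ j, AEStronglyMeasurable (u₀ j) volume) (hu₀ : ∀ j, Torus.HasZeroMean (u₀ j))
    {E : ℝ} (hE : ∀ j, meanEnergy (u j) ≤ E) {ε : ℝ}
    (hε : ∀ j, ε ≤ meanDissipation (ν j) (u j)) (j : ℕ) :
    max ε (4 * Real.pi ^ 2 * ν j * ((∫ x, ‖f x‖ ^ 2)
        - ν j * Real.sqrt (∫ x, ‖Torus.laplacian f x‖ ^ 2) * Real.sqrt E) / G) ≤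
      meanDissipation (ν j) (u j) :=
  max_le (hε j) (zerothLawFamily_laminarFloor hf hdiv hmean hG hG0 hν hLH hm₀ hu₀ hE j)

end Summit.AnomalousDissipation.AnomalousDissipation.Theorems

end
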